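import Summits.QuantumAdvantage.QuantumAdvantage.Theorems.SosSandwichCornerLiftB
import Literature.Computability.QuantumComplexity.AaronsonAmbainisL1Form

/-!
# SosSandwichCornerLift — part C (3/4): probability on the cube, the detector facts, the saturation step

Tree twin of `decomp-qadv/lens-5/g20/CornerLift.lean` §9–§10 (up to `saturate`). `half_var_le_parts`
(`E (p-μ)⁺ = E (p-μ)⁻ ≥ Var/2`), the window pigeonhole, `detector_facts` (a threshold `k` with
`g = E[cdf D k ∘ p] ∈ [ε/4, 1 - ε/8]` and `E t(cdf ∘ p) ≤ 5/(4W)` once `8/ε ≤ W ≤ D (ε/(8W))²`), and `saturate`: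
for `0 < η < 1/4`, `p ∈ K_T`, `Var p ≥ ε > 0` there are `y₀ = ⌈1/(ηε)⌉`, `s, m ≤ 65 y₀`, `D ≤ Kd·y₀¹¹`, `k` with
`Var (ampPoly s m D k p) ≥ 1/4 - η`.
-/

set_option linter.dupNamespace false
set_option autoImplicit false

noncomputable section

open Finset
open Literature.Computability.QuantumComplexity
open Summit.QuantumAdvantage.QuantumAdvantage.Theorems.SosSandwich

namespace Summit.QuantumAdvantage.QuantumAdvantage.Theorems.SosSandwich.CornerLift

variable {N : ℕ}

/-! ## §9 Probability facts on the cube used by the saturation argument -/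

section Prob

variable {N : ℕ}

/-- `boolAvg` of an affine image. [folklore] -/
theorem bavg_affine (a b : ℝ) (f : (Fin N → Bool) → ℝ) :
    boolAvg (fun x => a + b * f x) = a + b * boolAvg f := by
  rw [avg_add (fun _ => a) (fun x => b * f x), boolAvg_const, avg_const_mul]
/-- **First-moment split of the variance**: for `r ∈ [0,1]` with mean `μ`, both `E (r-μ)⁺` and
`E (r-μ)⁻` are at least `Var/2` (since `(r-μ)² ≤ |r-μ|` and `E(r-μ) = 0`). [folklore] -/
theorem half_var_le_parts {r : (Fin N → Bool) → ℝ} (hr0 : ∀ z, 0 ≤ r z) (hr1 : ∀ z, r z ≤ 1) :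
    boolAvg (fun z => (r z - boolAvg r) ^ 2) / 2 ≤ boolAvg (fun z => max (r z - boolAvg r) 0) ∧
    boolAvg (fun z => (r z - boolAvg r) ^ 2) / 2 ≤ boolAvg (fun z => max (boolAvg r - r z) 0) := by
  set μ := boolAvg r with hμ
  have hμ0 : 0 ≤ μ := boolAvg_nonneg hr0
  have hμ1 : μ ≤ 1 := Literature.Computability.QuantumComplexity.AaronsonAmbainisL1.boolAvg_le_one hr1
  have e1 : boolAvg (fun z => max (r z - μ) 0) - boolAvg (fun z => max (μ - r z) 0) = 0 := by
    rw [← avg_sub]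
    have : (fun z => max (r z - μ) 0 - max (μ - r z) 0) = fun z => r z - μ := by
      funext z
      rcases le_total (r z) μ with h | h
      · rw [max_eq_right (by linarith), max_eq_left (by linarith)]; ring
      · rw [max_eq_left (by linarith), max_eq_right (by linarith)]; ring
    rw [this, avg_sub r (fun _ => μ), boolAvg_const, hμ, sub_self]
  have e2 : boolAvg (fun z => (r z - μ) ^ 2) ≤
      boolAvg (fun z => max (r z - μ) 0) + boolAvg (fun z => max (μ - r z) 0) := by
    rw [← avg_add]
    refine Literature.Computability.QuantumComplexity.AaronsonAmbainisL1.boolAvg_mono fun z => ?_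
    have h0 := hr0 z; have h1 := hr1 z
    rcases le_total (r z) μ with h | h
    · rw [max_eq_right (by linarith), max_eq_left (by linarith)]; nlinarith
    · rw [max_eq_left (by linarith), max_eq_right (by linarith)]; nlinarith
  constructor <;> linarith
/-- At most one window of an arithmetic progression of disjoint windows contains a given point. -/
theorem sum_window_indicator_le_one (a θ₀ Δ : ℝ) (hΔ : 0 < Δ) (W : ℕ) :
    ∑ w ∈ Finset.range W,
      (if θ₀ + w * Δ ≤ a ∧ a < θ₀ + w * Δ + Δ then (1 : ℝ) else 0) ≤ 1 := by
  rw [Finset.sum_boole]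
  have hc : ((Finset.range W).filter fun w : ℕ => θ₀ + w * Δ ≤ a ∧ a < θ₀ + w * Δ + Δ).card ≤ 1 := by
    refine Finset.card_le_one.mpr fun w₁ h₁ w₂ h₂ => ?_
    simp only [Finset.mem_filter] at h₁ h₂
    have i1 : (w₁ : ℝ) < w₂ + 1 := by
      by_contra hh; push Not at hh
      have : θ₀ + w₂ * Δ + Δ ≤ θ₀ + w₁ * Δ := by nlinarith
      linarith [h₁.2.1, h₂.2.2]
    have i2 : (w₂ : ℝ) < w₁ + 1 := by
      by_contra hh; push Not at hh
      have : θ₀ + w₁ * Δ + Δ ≤ θ₀ + w₂ * Δ := by nlinarith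
      linarith [h₂.2.1, h₁.2.2]
    have j1 : w₁ < w₂ + 1 := by exact_mod_cast i1
    have j2 : w₂ < w₁ + 1 := by exact_mod_cast i2
    omega
  exact_mod_cast hc
end Prob
/-! ## §10 Saturation: `VarianceSaturation` PROVED -/
section Saturation
open MvPolynomial
variable {N : ℕ}
/-- **Detector facts.** For `p ∈ K_T` with `Var ≥ ε`, window count `W ≥ 8/ε` and Bernstein degree `D` with
`D Δ² ≥ W` (`Δ = ε/(8W)`), some threshold `k` makes `B = cdf D k` a good half-line detector of `p`:
`g = E[B∘p] ∈ [ε/4, 1 - ε/8]` and `E[t(B∘p)] ≤ 5/(4W)`. [folklore] -/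
theorem detector_facts {T : ℕ} {p : MvPolynomial (Fin N) ℝ} (hp : PseudoBounded T p) {ε : ℝ}
    (hε : 0 < ε) (hεV : ε ≤ boolVariance p) (W D : ℕ) (hW : 8 / ε ≤ (W : ℝ))
    (hD : (W : ℝ) ≤ D * (ε / (8 * W)) ^ 2) :
    ∃ k : ℕ, ε / 4 ≤ boolAvg (fun z => cdf D k (evalBool p z)) ∧
      boolAvg (fun z => cdf D k (evalBool p z)) ≤ 1 - ε / 8 ∧
      boolAvg (fun z => tcorner (cdf D k (evalBool p z))) ≤ 5 / (4 * W) := by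
  classical
  have hr0 : ∀ z, 0 ≤ evalBool p z := hp.eval_nonneg
  have hr1 : ∀ z, evalBool p z ≤ 1 := hp.eval_le_one
  obtain ⟨r, hr_def⟩ : ∃ r : (Fin N → Bool) → ℝ, r = evalBool p := ⟨_, rfl⟩
  rw [← hr_def] at hr0 hr1
  obtain ⟨μ, hμ_def⟩ : ∃ μ : ℝ, μ = boolAvg r := ⟨_, rfl⟩
  have hμ0 : 0 ≤ μ := hμ_def ▸ boolAvg_nonneg hr0
  have hμ1 : μ ≤ 1 := hμ_def ▸ Literature.Computability.QuantumComplexity.AaronsonAmbainisL1.boolAvg_le_one hr1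
  have hV : boolVariance p = boolAvg (fun z => (r z - μ) ^ 2) := by rw [hμ_def, hr_def]; rfl
  have hVq : boolVariance p ≤ 1 / 4 := boolVariance_le_quarter hp
  have hε1 : ε ≤ 1 / 4 := hεV.trans hVq
  -- the window width and the leakage
  have hW32 : (32 : ℝ) ≤ W := by
    have : (32 : ℝ) ≤ 8 / ε := by rw [le_div_iff₀ hε]; nlinarith
    linarith
  have hWpos : (0 : ℝ) < W := by linarith
  obtain ⟨Δ, hΔ_def⟩ : ∃ Δ : ℝ, Δ = ε / (8 * W) := ⟨_, rfl⟩
  have hΔ0 : 0 < Δ := by rw [hΔ_def]; positivity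
  have hWΔ : (W : ℝ) * Δ = ε / 8 := by rw [hΔ_def]; field_simp
  rw [← hΔ_def] at hD
  have hDpos : (0 : ℝ) < D := by
    by_contra hh; push Not at hh
    have : (D : ℝ) * Δ ^ 2 ≤ 0 := mul_nonpos_of_nonpos_of_nonneg hh (sq_nonneg Δ)
    linarith
  obtain ⟨δ, hδ_def⟩ : ∃ δ : ℝ, δ = 1 / (D * Δ ^ 2) := ⟨_, rfl⟩
  have hδ0 : 0 ≤ δ := by rw [hδ_def]; positivity
  have hδW : δ ≤ 1 / W := by rw [hδ_def]; exact one_div_le_one_div_of_le hWpos hD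
  have h1W : 1 / (W : ℝ) ≤ ε / 8 := by
    rw [div_le_div_iff₀ hWpos (by norm_num : (0:ℝ) < 8)]
    rw [div_le_iff₀ hε] at hW
    linarith
  have hδε : δ ≤ ε / 8 := hδW.trans h1W
  have hδhalf : δ ≤ 1 / 2 := by linarith
  -- the thin window (pigeonhole over `W` disjoint windows of `X = r - μ` inside `[ε/8, ε/4)`)
  obtain ⟨mass, hmass_def⟩ : ∃ mass : ℕ → ℝ, mass = fun w : ℕ => boolAvg (fun z =>
      if ε / 8 + (w : ℝ) * Δ ≤ r z - μ ∧ r z - μ < ε / 8 + (w : ℝ) * Δ + Δ then (1 : ℝ) else 0) :=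
    ⟨_, rfl⟩
  have hsum : ∑ w ∈ Finset.range W, mass w ≤ 1 := by
    have e : ∑ w ∈ Finset.range W, mass w = boolAvg (fun z => ∑ w ∈ Finset.range W,
        (if ε / 8 + w * Δ ≤ r z - μ ∧ r z - μ < ε / 8 + w * Δ + Δ then (1 : ℝ) else 0)) := by
      rw [hmass_def, boolAvg_eq_uavg]
      simp only [boolAvg_eq_uavg]
      exact (uavg_sum (Finset.range W) (fun (w : ℕ) (z : Fin N → Bool) =>
        if ε / 8 + w * Δ ≤ r z - μ ∧ r z - μ < ε / 8 + w * Δ + Δ then (1 : ℝ) else 0)).symm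
    rw [e]
    exact Literature.Computability.QuantumComplexity.AaronsonAmbainisL1.boolAvg_le_one fun z => sum_window_indicator_le_one (r z - μ) (ε / 8) Δ hΔ0 W
  have hne : (Finset.range W).Nonempty :=
    ⟨0, Finset.mem_range.mpr (by exact_mod_cast hWpos)⟩
  obtain ⟨w₀, hw₀, hmin⟩ := Finset.exists_min_image (Finset.range W) mass hne
  have hmass : mass w₀ ≤ 1 / W := by
    have h1 : (W : ℝ) * mass w₀ ≤ ∑ w ∈ Finset.range W, mass w := by
      have := Finset.sum_le_sum fun w hw => hmin w hw
      rwa [Finset.sum_const, Finset.card_range, nsmul_eq_mul] at this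
    rw [le_div_iff₀ hWpos]; linarith
  obtain ⟨θm, hθm_def⟩ : ∃ θm : ℝ, θm = ε / 8 + w₀ * Δ := ⟨_, rfl⟩
  have hw₀W : (w₀ : ℝ) + 1 ≤ W := by exact_mod_cast Nat.succ_le_of_lt (Finset.mem_range.mp hw₀)
  have hθm : ε / 8 ≤ θm := by
    have : (0 : ℝ) ≤ w₀ * Δ := by positivity
    linarith
  have hθp : θm + Δ ≤ ε / 4 := by
    have : (w₀ + 1) * Δ ≤ W * Δ := mul_le_mul_of_nonneg_right hw₀W hΔ0.le
    nlinarith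
  -- the threshold `k`: `k < D (μ + θm + Δ/2) ≤ k + 1`
  obtain ⟨x, hx_def⟩ : ∃ x : ℝ, x = D * (μ + θm + Δ / 2) := ⟨_, rfl⟩
  have hx0 : 0 < x := by
    have : 0 < μ + θm + Δ / 2 := by linarith
    rw [hx_def]; exact mul_pos hDpos this
  have hc0 : 0 < ⌈x⌉₊ := Nat.ceil_pos.mpr hx0
  obtain ⟨k, hk_def⟩ : ∃ k : ℕ, k = ⌈x⌉₊ - 1 := ⟨_, rfl⟩
  have hkc : (k : ℝ) + 1 = (⌈x⌉₊ : ℝ) := by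
    have : k + 1 = ⌈x⌉₊ := by rw [hk_def]; exact Nat.sub_add_cancel hc0
    exact_mod_cast this
  have hk1 : x ≤ (k : ℝ) + 1 := by rw [hkc]; exact Nat.le_ceil x
  have hk2 : (k : ℝ) < x := by have := Nat.ceil_lt_add_one hx0.le; linarith
  clear hkc hk_def hc0
  -- Chebyshev leakage
  obtain ⟨lam, hlam_def⟩ : ∃ lam : ℝ, lam = D * Δ / 2 := ⟨_, rfl⟩
  have hlam : 0 < lam := by rw [hlam_def]; positivity
  have tail_bound : ∀ z, (D : ℝ) * r z * (1 - r z) / lam ^ 2 ≤ δ := by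
    intro z
    have h4 : 4 * (r z * (1 - r z)) ≤ 1 := by nlinarith [sq_nonneg (r z - 1 / 2)]
    have hD0 : (D : ℝ) ≠ 0 := hDpos.ne'
    have hΔne : Δ ≠ 0 := hΔ0.ne'
    have e : (D : ℝ) * r z * (1 - r z) / lam ^ 2 = (4 * (r z * (1 - r z))) * δ := by
      rw [hlam_def, hδ_def]; field_simp; ring
    rw [e]
    calc 4 * (r z * (1 - r z)) * δ ≤ 1 * δ := mul_le_mul_of_nonneg_right h4 hδ0
      _ = δ := one_mul δ
  have lowTail : ∀ z, r z - μ ≤ θm → 1 - cdf D k (r z) ≤ δ := by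
    intro z hz
    refine (one_sub_cdf_le_of_le D k (hr0 z) (hr1 z) hlam ?_).trans (tail_bound z)
    have : (D : ℝ) * r z ≤ D * (μ + θm) := mul_le_mul_of_nonneg_left (by linarith) hDpos.le
    have : (D : ℝ) * r z + lam ≤ x := by rw [hx_def, hlam_def]; linarith
    linarith
  have highTail : ∀ z, θm + Δ ≤ r z - μ → cdf D k (r z) ≤ δ := by
    intro z hz
    refine (cdf_le_of_le D k (hr0 z) (hr1 z) hlam ?_).trans (tail_bound z)
    have : (D : ℝ) * (μ + θm + Δ) ≤ D * r z := mul_le_mul_of_nonneg_left (by linarith) hDpos.le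
    have : x ≤ D * r z - lam := by rw [hx_def, hlam_def]; linarith
    linarith
  -- pointwise detector facts
  have P1 : ∀ z, (1 - δ) * max (μ - r z) 0 ≤ cdf D k (r z) := by
    intro z
    rcases le_or_gt (r z) μ with h | h
    · rw [max_eq_left (by linarith)]
      have hlt := lowTail z (by linarith)
      have h1 : μ - r z ≤ 1 := by linarith [hr0 z]
      have h2 : (1 - δ) * (μ - r z) ≤ (1 - δ) * 1 := mul_le_mul_of_nonneg_left h1 (by linarith)
      linarith
    · rw [max_eq_right (by linarith), mul_zero]; exact cdf_nonneg D k (hr0 z) (hr1 z)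
  have P2 : ∀ z, cdf D k (r z) ≤ (1 + (1 - δ) * (θm + Δ)) + (-(1 - δ)) * max (r z - μ) 0 := by
    intro z
    rcases le_or_gt (θm + Δ) (r z - μ) with h | h
    · rw [max_eq_left (by linarith)]
      have hht := highTail z h
      have h1 : r z - μ - (θm + Δ) ≤ 1 := by linarith [hr1 z]
      have h2 : (1 - δ) * (r z - μ - (θm + Δ)) ≤ (1 - δ) * 1 := mul_le_mul_of_nonneg_left h1 (by linarith)
      linarith
    · have hmx : max (r z - μ) 0 ≤ θm + Δ := max_le h.le (by linarith)
      have hc1 := cdf_le_one D k (hr0 z) (hr1 z)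
      have h2 : (1 - δ) * max (r z - μ) 0 ≤ (1 - δ) * (θm + Δ) := mul_le_mul_of_nonneg_left hmx (by linarith)
      linarith
  have P3 : ∀ z, tcorner (cdf D k (r z)) ≤
      δ + (1 / 4) * (if ε / 8 + w₀ * Δ ≤ r z - μ ∧ r z - μ < ε / 8 + w₀ * Δ + Δ then (1 : ℝ) else 0) := by
    intro z
    rw [← hθm_def]
    by_cases hwin : θm ≤ r z - μ ∧ r z - μ < θm + Δ
    · rw [if_pos hwin]; have := tcorner_le_quarter (cdf D k (r z)); linarith
    · rw [if_neg hwin, mul_zero, add_zero]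
      rcases lt_or_ge (r z - μ) θm with h | h
      · exact (tcorner_le_one_sub _).trans (lowTail z h.le)
      · have h' : θm + Δ ≤ r z - μ := by
          by_contra hh; push Not at hh; exact hwin ⟨h, hh⟩
        exact (tcorner_le_self _).trans (highTail z h')
  -- averages
  obtain ⟨hVpos, hVneg⟩ := half_var_le_parts hr0 hr1
  rw [← hμ_def, ← hV] at hVpos hVneg
  have hg_lo : ε / 4 ≤ boolAvg (fun z => cdf D k (r z)) := by
    have h1 : (1 - δ) * boolAvg (fun z => max (μ - r z) 0) ≤ boolAvg (fun z => cdf D k (r z)) := by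
      rw [← avg_const_mul]; exact Literature.Computability.QuantumComplexity.AaronsonAmbainisL1.boolAvg_mono P1
    have h2 : ε / 2 ≤ boolAvg (fun z => max (μ - r z) 0) := by linarith
    have h3 : (1 - δ) * (ε / 2) ≤ (1 - δ) * boolAvg (fun z => max (μ - r z) 0) :=
      mul_le_mul_of_nonneg_left h2 (by linarith only [hδhalf])
    linarith only [h1, h3, mul_nonneg hε.le (by linarith only [hδhalf] : (0 : ℝ) ≤ 1 / 2 - δ)]
  have hg_hi : boolAvg (fun z => cdf D k (r z)) ≤ 1 - ε / 8 := by
    have h1 : boolAvg (fun z => cdf D k (r z)) ≤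
        (1 + (1 - δ) * (θm + Δ)) + (-(1 - δ)) * boolAvg (fun z => max (r z - μ) 0) := by
      rw [← bavg_affine]; exact Literature.Computability.QuantumComplexity.AaronsonAmbainisL1.boolAvg_mono P2
    have h2 : ε / 2 ≤ boolAvg (fun z => max (r z - μ) 0) := by linarith
    have h3 : (1 - δ) * (θm + Δ - boolAvg (fun z => max (r z - μ) 0)) ≤ (1 - δ) * (ε / 4 - ε / 2) :=
      mul_le_mul_of_nonneg_left (by linarith only [hθp, h2]) (by linarith only [hδhalf])
    linarith only [h1, h3, mul_nonneg hε.le (by linarith only [hδhalf] : (0 : ℝ) ≤ 1 / 2 - δ)]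
  have ht : boolAvg (fun z => tcorner (cdf D k (r z))) ≤ 5 / (4 * W) := by
    have h1 : boolAvg (fun z => tcorner (cdf D k (r z))) ≤ δ + (1 / 4) * mass w₀ := by
      rw [hmass_def, ← bavg_affine]; exact Literature.Computability.QuantumComplexity.AaronsonAmbainisL1.boolAvg_mono P3
    calc boolAvg (fun z => tcorner (cdf D k (r z))) ≤ δ + (1 / 4) * mass w₀ := h1
      _ ≤ 1 / W + (1 / 4) * (1 / W) := by linarith
      _ = 5 / (4 * W) := by field_simp; ring
  refine ⟨k, ?_, ?_, ?_⟩
  · rw [← hr_def]; exact hg_lo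
  · rw [← hr_def]; exact hg_hi
  · rw [← hr_def]; exact ht

/-- The Bernstein-degree constant: `D ≤ Kd · y₀¹¹`. -/
def Kd : ℝ := 64 * 33808 ^ 3 + 1

/-- `Kd ≥ 0`. [folklore] -/
theorem Kd_nonneg : 0 ≤ Kd := by unfold Kd; positivity

set_option maxHeartbeats 2000000 in
/-- **Saturation with explicit integer parameters** (the case `η < 1/4`). [folklore] -/
theorem saturate {η : ℝ} (hη0 : 0 < η) (hη1 : η < 1 / 4) {T : ℕ} {p : MvPolynomial (Fin N) ℝ}
    {ε : ℝ} (hp : PseudoBounded T p) (hε : 0 < ε) (hεV : ε ≤ boolVariance p) :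
    ∃ (y₀ s m D k : ℕ), (1 : ℝ) ≤ y₀ ∧ (y₀ : ℝ) ≤ 2 / (η * ε) ∧ 1 ≤ s ∧ 1 ≤ m ∧ 1 ≤ D ∧
      (s : ℝ) ≤ 65 * y₀ ∧ (m : ℝ) ≤ 65 * y₀ ∧ (D : ℝ) ≤ Kd * (y₀ : ℝ) ^ 11 ∧
      1 / 4 - η ≤ boolVariance (ampPoly s m D k p) := by
  classical
  have hVq : boolVariance p ≤ 1 / 4 := boolVariance_le_quarter hp
  have hε1 : ε ≤ 1 / 4 := hεV.trans hVq
  have hηε : 0 < η * ε := mul_pos hη0 hε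
  have hinv1 : 1 ≤ 1 / (η * ε) := by rw [le_div_iff₀ hηε]; nlinarith
  obtain ⟨y₀, hy₀_def⟩ : ∃ y₀ : ℕ, y₀ = ⌈1 / (η * ε)⌉₊ := ⟨_, rfl⟩
  have hy₀ : 1 / (η * ε) ≤ y₀ := hy₀_def ▸ Nat.le_ceil _
  have hy₀1 : (1 : ℝ) ≤ y₀ := hinv1.trans hy₀
  have hy₀2 : (y₀ : ℝ) ≤ 2 / (η * ε) := by
    have h := Nat.ceil_lt_add_one (show (0 : ℝ) ≤ 1 / (η * ε) by positivity)
    rw [← hy₀_def] at h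
    have : 2 / (η * ε) = 1 / (η * ε) + 1 / (η * ε) := by ring
    linarith
  have hy₀η : 1 / η ≤ y₀ :=
    (one_div_le_one_div_of_le hηε (by nlinarith)).trans hy₀
  have hy₀ε : 1 / ε ≤ y₀ :=
    (one_div_le_one_div_of_le hηε (by nlinarith)).trans hy₀
  clear hy₀_def
  obtain ⟨W, hW_def⟩ : ∃ W : ℕ, W = 8 * (65 * y₀) ^ 2 * y₀ + 8 * y₀ := ⟨_, rfl⟩
  obtain ⟨D, hD_def⟩ : ∃ D : ℕ, D = 64 * W ^ 3 * y₀ ^ 2 + 1 := ⟨_, rfl⟩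
  have hWR : (W : ℝ) = 8 * (65 * y₀) ^ 2 * y₀ + 8 * y₀ := by rw [hW_def]; push_cast; ring
  have hDR : (D : ℝ) = 64 * (W : ℝ) ^ 3 * (y₀ : ℝ) ^ 2 + 1 := by rw [hD_def]; push_cast; ring
  have hD1 : 1 ≤ D := by rw [hD_def]; exact Nat.le_add_left 1 _
  clear hW_def hD_def
  have hW8 : 8 / ε ≤ (W : ℝ) := by
    rw [hWR]
    have : 8 / ε = 8 * (1 / ε) := by ring
    have : (0 : ℝ) ≤ 8 * (65 * y₀) ^ 2 * y₀ := by positivity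
    linarith
  have hWpos : (0 : ℝ) < W := lt_of_lt_of_le (by positivity) hW8
  have hDW : (W : ℝ) ≤ D * (ε / (8 * W)) ^ 2 := by
    have h1 : (1 : ℝ) ≤ y₀ * ε := by rw [div_le_iff₀ hε] at hy₀ε; linarith
    have h2 : (64 : ℝ) * W ^ 3 * y₀ ^ 2 ≤ D := by rw [hDR]; linarith
    have e : (D : ℝ) * (ε / (8 * W)) ^ 2 = D * ε ^ 2 / (64 * W ^ 2) := by
      field_simp; ring
    rw [e, le_div_iff₀ (by positivity)]
    calc (W : ℝ) * (64 * W ^ 2) = 64 * W ^ 3 * 1 := by ring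
      _ ≤ 64 * W ^ 3 * (y₀ * ε) ^ 2 := by
          apply mul_le_mul_of_nonneg_left _ (by positivity)
          nlinarith
      _ = (64 * W ^ 3 * y₀ ^ 2) * ε ^ 2 := by ring
      _ ≤ D * ε ^ 2 := mul_le_mul_of_nonneg_right h2 (sq_nonneg ε)
  obtain ⟨k, hg_lo, hg_hi, ht⟩ := detector_facts hp hε hεV W D hW8 hDW
  obtain ⟨g, hg_def⟩ : ∃ g : ℝ, g = boolAvg (fun z => cdf D k (evalBool p z)) := ⟨_, rfl⟩
  rw [← hg_def] at hg_lo hg_hi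
  -- the AND-width `m`
  obtain ⟨m, hm1, hum, hul, hmB⟩ := exists_pow_window (g := g) (g₀ := ε / 4) (gbar := 1 - ε / 8)
    (τ := η / 8) (by positivity) hg_lo hg_hi (by linarith) (by positivity) (by linarith)
  obtain ⟨u, hu_def⟩ : ∃ u : ℝ, u = g ^ m := ⟨_, rfl⟩
  rw [← hu_def] at hum hul
  have hu0 : 0 < u := lt_of_le_of_lt (by positivity) hul
  have huε : η * ε / 32 < u := by linarith
  -- the OR-width `s`
  obtain ⟨s, hs1, hus, husl, hsB⟩ := exists_pow_window (g := 1 - u) (g₀ := 1 - u) (gbar := 1 - u)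
    (τ := 1 / 2) (by linarith) le_rfl le_rfl (by linarith) (by norm_num) (by norm_num)
  -- sizes
  have h64 : 64 / (η * ε) ≤ 64 * (y₀ : ℝ) := by
    have : 64 / (η * ε) = 64 * (1 / (η * ε)) := by ring
    rw [this]; linarith
  have hmR : (m : ℝ) ≤ 65 * y₀ := by
    have e : 1 / (η / 8 * (1 - (1 - ε / 8))) = 64 / (η * ε) := by ring
    rw [e] at hmB; linarith
  have hsR : (s : ℝ) ≤ 65 * y₀ := by
    have e : 1 / (1 / 2 * (1 - (1 - u))) = 2 / u := by ring
    rw [e] at hsB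
    have : 2 / u < 64 / (η * ε) := by
      rw [div_lt_div_iff₀ hu0 hηε]; nlinarith
    linarith
  have hDK : (D : ℝ) ≤ Kd * (y₀ : ℝ) ^ 11 := by
    have hy3 : (y₀ : ℝ) ≤ y₀ ^ 3 := le_self_pow₀ hy₀1 (by norm_num)
    have hW' : (W : ℝ) ≤ 33808 * y₀ ^ 3 := by rw [hWR]; nlinarith
    have h11 : (1 : ℝ) ≤ y₀ ^ 11 := one_le_pow₀ hy₀1
    rw [hDR, Kd]
    calc 64 * (W : ℝ) ^ 3 * (y₀ : ℝ) ^ 2 + 1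
        ≤ 64 * (33808 * (y₀ : ℝ) ^ 3) ^ 3 * (y₀ : ℝ) ^ 2 + (y₀ : ℝ) ^ 11 := by gcongr
      _ = (64 * 33808 ^ 3 + 1) * (y₀ : ℝ) ^ 11 := by ring
  refine ⟨y₀, s, m, D, k, hy₀1, hy₀2, hs1, hm1, hD1, hsR, hmR, hDK, ?_⟩
  -- the variance of the amplified polynomial
  have hmean : boolAvg (evalBool (ampPoly s m D k p)) = 1 - (1 - u) ^ s := by
    rw [boolAvg_ampPoly, ← hg_def, ← hu_def]
  have hcorner := boolVariance_eq_corner (ampPoly s m D k p)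
  have hbudget : boolAvg (fun x => evalBool (ampPoly s m D k p) x * (1 - evalBool (ampPoly s m D k p) x)) ≤
      5 * η / 32 := by
    have h1 := boolAvg_tcorner_ampPoly_le hp s m D k
    have h2 : (s * m : ℝ) * boolAvg (fun z => tcorner (cdf D k (evalBool p z))) ≤ (s * m : ℝ) * (5 / (4 * W)) :=
      mul_le_mul_of_nonneg_left ht (by positivity)
    have hsm : (s : ℝ) * m ≤ (65 * y₀) ^ 2 :=
      calc (s : ℝ) * m ≤ (65 * y₀) * m := mul_le_mul_of_nonneg_right hsR (Nat.cast_nonneg _)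
        _ ≤ (65 * y₀) * (65 * y₀) := mul_le_mul_of_nonneg_left hmR (by positivity)
        _ = (65 * y₀) ^ 2 := by ring
    have hW2 : 8 * (65 * (y₀ : ℝ)) ^ 2 * y₀ ≤ W := by
      rw [hWR]; have : (0 : ℝ) ≤ y₀ := Nat.cast_nonneg _; linarith
    have hηy : 1 ≤ η * y₀ := by rw [div_le_iff₀ hη0] at hy₀η; linarith
    have h3 : (s * m : ℝ) * (5 / (4 * W)) ≤ 5 * η / 32 :=
      calc (s * m : ℝ) * (5 / (4 * W)) ≤ (65 * y₀) ^ 2 * (5 / (4 * W)) :=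
            mul_le_mul_of_nonneg_right hsm (by positivity)
        _ = (5 * (65 * y₀) ^ 2 / 4) / W := by ring
        _ ≤ (5 * (65 * y₀) ^ 2 / 4) / (8 * (65 * (y₀ : ℝ)) ^ 2 * y₀) :=
            div_le_div_of_nonneg_left (by positivity) (by positivity) hW2
        _ = 5 / (32 * y₀) := by field_simp; ring
        _ ≤ 5 * η / 32 := by
            have hy0 : (0 : ℝ) < y₀ := by linarith only [hy₀1]
            rw [div_le_iff₀ (by positivity)]
            nlinarith only [hηy, hy0, hη0]
    exact (h1.trans h2).trans h3
  have hμ'1 : 1 / 2 ≤ boolAvg (evalBool (ampPoly s m D k p)) := by rw [hmean]; linarith only [hus]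
  have hμ'2 : boolAvg (evalBool (ampPoly s m D k p)) ≤ 1 / 2 + η / 16 := by
    rw [hmean]; linarith only [husl, hum]
  have hsq : (boolAvg (evalBool (ampPoly s m D k p)) - 1 / 2) ^ 2 ≤ (η / 16) ^ 2 :=
    pow_le_pow_left₀ (by linarith) (by linarith) 2
  have hη2 : η ^ 2 ≤ η * (1 / 4) := by nlinarith
  rw [hcorner]
  nlinarith

end Saturation

end Summit.QuantumAdvantage.QuantumAdvantage.Theorems.SosSandwich.CornerLift

end
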